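import Mathlib.AlgebraicGeometry.Modules.Sheaf
import Mathlib.Algebra.Category.ModuleCat.Sheaf.LocallyFree
import Mathlib.Algebra.Category.ModuleCat.Sheaf.Generators
import Mathlib.Algebra.Homology.ShortComplex.ShortExact
import Mathlib.CategoryTheory.Limits.Shapes.Biproducts
import Mathlib.Data.Finset.NatAntidiagonal
import Literature.AlgebraicGeometry.Motives.PreWeilCohomology
import HarnessLib

-- provenance: harness21/H21/H21/Prelude/MotiveL/ChernClasses.lean @ c717367 (interim HEAD d8f2665); M5 mechanical rewrite
/-!
# Axiomatic Chern classes with values in a Weil cohomology theory (trunk MotiveL, prelude C14)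

Following Grothendieck, *La théorie des classes de Chern* (1958), §§1–3, and Fulton,
*Intersection theory*, §3.2, a *theory of Chern classes* with values in (the data of) a Weil
cohomology theory `W : Literature.PreWeilCohomology k K` assigns to every `𝒪_X`-module `E` on a
`k`-scheme `X` classes `cᵢ(E) ∈ H²ⁱ(X)`, `i ∈ ℕ`, subject to the axioms

* `c₀(E) = 1`;
* functoriality `f* cᵢ(E) = cᵢ(f* E)` for vector bundles `E`
  (Grothendieck 1958 Thm 1 (i); Fulton Thm 3.2 (d));
* the Whitney sum formula `c(E) = c(E') c(E'')` for a short exact sequence of vector bundles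
  `0 → E' → E → E'' → 0` (Grothendieck 1958 Thm 1 (iii); Fulton Thm 3.2 (e));
* vanishing `cᵢ(E) = 0` for `i > rank E` (Fulton Thm 3.2 (a); Grothendieck 1958 §3);
* invariance under isomorphism, and algebraicity: on a smooth projective variety `cᵢ(E)` is the
  class of an algebraic cycle with `ℚ`-coefficients (Grothendieck 1958 §3 gives the integral
  statement `cᵢ(E) ∈ Aⁱ(X)`; only the weaker `ℚ`-version, which is what the standard
  conjectures consume, is axiomatised here).

The normalisation `c₁(𝒪(D)) = [D]` (Grothendieck 1958 Thm 1 (ii)) is **not** stated: v0 has no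
divisor / line-bundle dictionary. Consequently the uniqueness of Chern classes (Grothendieck 1958
Thm 1) is not stated either, and `Literature.ChernClassTheory W` is a structure of which a given `W` may
carry several instances.

## Main definitions

* `Literature.IsVectorBundle E`: the `𝒪_X`-module `E` is locally free of finite type (a vector bundle).
  Both conjuncts are Mathlib's: `SheafOfModules.IsLocallyFree` and `SheafOfModules.IsFiniteType`.
* `Literature.HasRankLE E r`: `E` admits local trivialisations `𝒪^{I} ≅ E|_U` with `#I ≤ r`.
* `Literature.HasFullFlag E`: `E` is a successive extension of vector bundles of rank `≤ 1`
  (inductive predicate; Fulton §3.2, "splitting construction").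
* `Literature.ChernClassTheory W`: the structure of Chern data + axioms above.
* `Literature.AlgebraicGeometry.Motives.ChernClassTheory.cupEven`: the cup product `H²ⁱ ⊗ H²ʲ → H²ᵐ` for `i + j = m`.
* `Literature.ChernClassTheory.totalChern C X E`: the total Chern class as a graded family.
* `Literature.ChernClassTheory.SplittingPrinciple W`: the splitting principle as a `Prop` schema.

## Design choices

* Mathlib has `𝒪_X`-modules (`AlgebraicGeometry.Scheme.Modules`, an abelian category with
  pull-back functors `Scheme.Modules.pullback`), locally free sheaves and sheaves of finite type,
  but no Chern classes, no rank function and no projective bundles (searched `Chern`, `chern`,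
  `VectorBundle` in `Mathlib/AlgebraicGeometry` and `Mathlib/Algebra/Category/ModuleCat/Sheaf`:
  nothing relevant; `Mathlib.Topology.VectorBundle` is the topological notion). Hence Chern classes
  are axiomatised as a structure over `W`, in the style of `Literature.AlgebraicGeometry.Motives.PreWeilCohomology`.
* `C.chern X E i` is a total function of all `𝒪_X`-modules `E`; it is meaningful on vector bundles
  only, and the axioms of functoriality, Whitney sum and algebraicity carry `IsVectorBundle`
  hypotheses (a genuine theory on bundles extends to all modules by `cᵢ := δᵢ₀ · 1`, so the
  hypothesis-free axioms `chern_zero`, `chern_congr` are harmless).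
* Degrees: `cᵢ(E) : W.obj X (2 * i)`; the Whitney formula is a sum over `Finset.antidiagonal m`
  with the degree identity `2 i + 2 j = 2 m` discharged inside `cupEven` (cast-free bookkeeping, as
  in `Literature.AlgebraicGeometry.Motives.PreWeilCohomology.kunnethMap`).
* Vanishing above the rank is axiomatised through `HasRankLE` (local trivialisations of bounded
  size) rather than through a rank function, which Mathlib lacks.

## References

* A. Grothendieck, *La théorie des classes de Chern*, Bull. SMF 86 (1958), §§1–3, Thm 1.
* W. Fulton, *Intersection theory*, 2nd ed. (1998), §3.2, Thm 3.2, Rem. 3.2.3.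
* The Stacks project, Tags 01C6 (locally free), 01B4 (finite type), 02UK (Chern classes).
-/

universe u v

open CategoryTheory AlgebraicGeometry Limits

noncomputable section

namespace Literature.AlgebraicGeometry.Motives

/-! ## Vector bundles -/

section VectorBundle

variable {X : Scheme.{u}}

/-- An `𝒪_X`-module `E` *is a vector bundle* (a locally free sheaf of finite type): it is locally
free (Mathlib `SheafOfModules.IsLocallyFree`, Stacks 01C6) and of finite type (Mathlib
`SheafOfModules.IsFiniteType`, Stacks 01B4); equivalently, finite locally free
(Hartshorne II.5; Fulton B.3). [folklore] -/
def IsVectorBundle (E : X.Modules) : Prop :=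
  SheafOfModules.IsLocallyFree.{u, u, u} E ∧ SheafOfModules.IsFiniteType.{u, u, u} E

/-- A vector bundle is locally free. [folklore] -/
lemma IsVectorBundle.isLocallyFree {E : X.Modules} (h : IsVectorBundle E) :
    SheafOfModules.IsLocallyFree.{u, u, u} E := h.1

/-- A vector bundle is of finite type. [folklore] -/
lemma IsVectorBundle.isFiniteType {E : X.Modules} (h : IsVectorBundle E) :
    SheafOfModules.IsFiniteType.{u, u, u} E := h.2

/-- The `𝒪_X`-module `E` *has rank at most `r`*: there are local generators data
`q` for `E` (an open cover `U_a` of `X` with sections generating `E|_{U_a}`) which are locally free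
data (the maps `𝒪^{I_a}_{U_a} → E|_{U_a}` are isomorphisms) with `#I_a ≤ r` for all `a`
(Hartshorne II.5, rank of a locally free sheaf; Fulton B.3). Mathlib has no rank function for
locally free sheaves; this bounded form is what the vanishing axiom of Chern classes consumes. [folklore] -/
def HasRankLE (E : X.Modules) (r : ℕ) : Prop :=
  ∃ q : SheafOfModules.LocalGeneratorsData.{u} (R := X.ringCatSheaf) E,
    q.IsLocallyFreeData ∧ ∀ a, Finite (q.generators a).I ∧ Nat.card (q.generators a).I ≤ r

/-- A module of rank at most `r` has rank at most `s` for `r ≤ s`. [folklore] -/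
lemma HasRankLE.mono {E : X.Modules} {r s : ℕ} (h : HasRankLE E r) (hrs : r ≤ s) :
    HasRankLE E s := by
  obtain ⟨q, hq, hr⟩ := h
  exact ⟨q, hq, fun a ↦ ⟨(hr a).1, (hr a).2.trans hrs⟩⟩

/-- A module of rank at most `r` is a vector bundle. [folklore] -/
lemma HasRankLE.isVectorBundle {E : X.Modules} {r : ℕ} (h : HasRankLE E r) :
    IsVectorBundle E := by
  obtain ⟨q, hq, hr⟩ := h
  have hq' : SheafOfModules.LocalGeneratorsData.IsFiniteType
      (J := Opens.grothendieckTopology X) (R := X.ringCatSheaf) q :=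
    { isFiniteType := fun a ↦ { finite := (hr a).1 } }
  exact ⟨{ exists_isLocallyFreeData := ⟨q, hq⟩ }, { exists_localGeneratorsData := ⟨q, hq'⟩ }⟩

/-- The `𝒪_X`-module `E` *has a full flag*: it is a successive extension of vector bundles of
rank at most `1`, i.e. either `E` is a zero object, or there is a short exact sequence
`0 → E' → E → L → 0` with `E'` having a full flag and `L` of rank `≤ 1`
(Fulton §3.2, splitting construction; Grothendieck 1958 §2). [cite: Grothendieck1958, §2] -/
inductive HasFullFlag : X.Modules → Prop
  /-- A zero module has the empty flag. -/
  | of_isZero (E : X.Modules) (hE : IsZero E) : HasFullFlag E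
  /-- An extension of a module of rank `≤ 1` by a module with a full flag has a full flag. -/
  | of_shortExact (S : ShortComplex X.Modules) (hS : S.ShortExact) (h₁ : HasFullFlag S.X₁)
      (h₃ : HasRankLE S.X₃ 1) : HasFullFlag S.X₂

/-- A zero module has rank at most `0`: the empty family of sections generates `E = 0` over
the trivial cover, and `𝒪_X^∅ = 0 ⟶ E = 0` is an isomorphism. [folklore] -/
lemma hasRankLE_zero_of_isZero {E : X.Modules} (hE : IsZero E) : HasRankLE E 0 := by
  have h0 : IsZero (SheafOfModules.free (R := X.ringCatSheaf) PEmpty.{u + 1}) := by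
    rw [IsZero.iff_id_eq_zero]
    exact Limits.Sigma.hom_ext _ _ (fun i ↦ i.elim)
  let G : E.GeneratingSections :=
    { I := PEmpty.{u + 1}
      s := PEmpty.elim
      epi := hE.epi _ }
  haveI : IsIso G.π := h0.isIso hE _
  have hG : SheafOfModules.LocalGeneratorsData.IsLocallyFreeData
      (J := Opens.grothendieckTopology X) (R := X.ringCatSheaf) G.localGeneratorsData :=
    { isIso := fun x ↦
        (inferInstance : IsIso (G.map (SheafOfModules.pushforward.{u}
          (𝟙 (X.ringCatSheaf.over x))) (Iso.refl _)).π) }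
  exact ⟨G.localGeneratorsData, hG,
    fun _ ↦ ⟨inferInstanceAs (Finite PEmpty.{u + 1}), by simp⟩⟩

/-- The free module `𝒪_X^I` on a finite type `I` has rank at most `#I` (the tautological
trivialisation over the trivial cover; Mathlib's
`SheafOfModules.free.generatingSections`). [folklore] -/
lemma hasRankLE_free (I : Type u) [Finite I] :
    HasRankLE (SheafOfModules.free (R := X.ringCatSheaf) I) (Nat.card I) :=
  ⟨(SheafOfModules.free.generatingSections I).localGeneratorsData, inferInstance,
    fun _ ↦ ⟨‹Finite I›, le_rfl⟩⟩

/-- A module with a full flag is a vector bundle. By induction along the flag this is the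
statement that an extension `0 → E' → E → L → 0` of finite locally free `𝒪_X`-modules on a
scheme `X` is finite locally free: it is of finite type by Stacks, Modules Lemma 17.9.3
(Tag 01B7); it is quasi-coherent as an extension of quasi-coherent modules on a scheme
(Tag 01LA), and on an affine open `U = Spec A` the module `L(U)` is finite projective
(Tags 05JM, 00NX = Algebra Lemma 10.78.2), so the sequence splits over `U` and
`E|_U ≅ E'|_U ⊕ L|_U` is finite locally free (for `X` noetherian this is also Hartshorne II
Ex. 5.7 (b), via stalks). Needed to iterate the Whitney formula along a flag. Named fact
(usage `(h : HasFullFlag.isVectorBundle (X := X))`). [cite: StacksProject, Tag 01B7 (Modules Lemma 17.9.3) with Tags 01LA 05JM 00NX] [cite: Hartshorne1977, II Ex. 5.7 (b)] -/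
def HasFullFlag.isVectorBundle : Prop :=
  ∀ {E : X.Modules}, HasFullFlag E → IsVectorBundle E

/-- The trivial bundle `𝒪_X^I` is a vector bundle. [folklore] -/
lemma isVectorBundle_free (I : Type u) [Finite I] :
    IsVectorBundle (SheafOfModules.free (R := X.ringCatSheaf) I) :=
  (hasRankLE_free I).isVectorBundle

end VectorBundle

/-! ## Chern class theories -/

variable {k : Type u} [Field k] {K : Type v} [Field K]

namespace ChernClassTheory

/-- The cup product `H²ⁱ(X) →ₗ H²ʲ(X) →ₗ H²ᵐ(X)` for `i + j = m`, i.e. `W.cup` with the degree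
identity `2 i + 2 j = 2 m` discharged (Kleiman 1968 §1.2; used in the Whitney sum formula,
Fulton Thm 3.2 (e)). [cite: Kleiman1968, §1.2] -/
def cupEven (W : PreWeilCohomology k K) (X : SchemeOver k) {i j m : ℕ} (h : i + j = m) :
    W.obj X (2 * i) →ₗ[K] W.obj X (2 * j) →ₗ[K] W.obj X (2 * m) :=
  W.cup (by omega)

end ChernClassTheory

/-- A *theory of Chern classes* with values in the pre-Weil cohomology theory `W`
(Grothendieck 1958 §§1–3, Thm 1; Fulton §3.2, Thm 3.2): classes `cᵢ(E) ∈ H²ⁱ(X)` for every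
`𝒪_X`-module `E` on a `k`-scheme `X` (meaningful for vector bundles), with `c₀ = 1`,
invariance under isomorphism, and, for vector bundles, functoriality under pull-back, the Whitney
sum formula for short exact sequences, vanishing above the rank, and algebraicity (with
`ℚ`-coefficients) on smooth projective varieties. The normalisation `c₁(𝒪(D)) = [D]` (Grothendieck 1958 Thm 1 (ii)) is not part of the
structure (no divisor / line-bundle dictionary in v0), so uniqueness is not asserted. [cite: Grothendieck1958, §§1–3  Thm 1] -/
structure ChernClassTheory (W : PreWeilCohomology k K) where
  /-- The `i`-th Chern class `cᵢ(E) ∈ H²ⁱ(X)` of the `𝒪_X`-module `E`. -/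
  chern (X : SchemeOver k) (E : X.left.Modules) (i : ℕ) : W.obj X (2 * i)
  /-- `c₀(E) = 1` (Fulton Thm 3.2). -/
  chern_zero (X : SchemeOver k) (E : X.left.Modules) : chern X E 0 = W.one X
  /-- Functoriality `f* cᵢ(E) = cᵢ(f* E)` for a vector bundle `E`
  (Grothendieck 1958 Thm 1 (i); Fulton Thm 3.2 (d)). -/
  pullback_chern {X Y : SchemeOver k} (f : X ⟶ Y) (E : Y.left.Modules) (hE : IsVectorBundle E)
    (i : ℕ) :
    W.pullback f (2 * i) (chern Y E i) = chern X ((Scheme.Modules.pullback f.left).obj E) i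
  /-- Isomorphic modules have the same Chern classes. -/
  chern_congr {X : SchemeOver k} {E F : X.left.Modules} (e : E ≅ F) (i : ℕ) :
    chern X E i = chern X F i
  /-- The Whitney sum formula `c_m(E) = ∑_{i+j=m} cᵢ(E') ∪ cⱼ(E'')` for a short exact sequence of
  vector bundles `0 → E' → E → E'' → 0` (Grothendieck 1958 Thm 1 (iii); Fulton Thm 3.2 (e)). -/
  chern_whitney {X : SchemeOver k} (S : ShortComplex X.left.Modules) (hS : S.ShortExact)
    (h₁ : IsVectorBundle S.X₁) (h₃ : IsVectorBundle S.X₃) (m : ℕ) :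
    chern X S.X₂ m = ∑ ij : Finset.antidiagonal m,
      ChernClassTheory.cupEven W X (Finset.mem_antidiagonal.mp ij.2)
        (chern X S.X₁ ij.1.1) (chern X S.X₃ ij.1.2)
  /-- Vanishing above the rank: `cᵢ(E) = 0` for `i > rank E` (Fulton Thm 3.2 (a);
  Grothendieck 1958 §3). -/
  chern_eq_zero_of_hasRankLE {X : SchemeOver k} {E : X.left.Modules} {r : ℕ}
    (hE : HasRankLE E r) {i : ℕ} (hi : r < i) : chern X E i = 0
  /-- Algebraicity: on a smooth projective variety, `cᵢ(E)` of a vector bundle is the class of a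
  codimension-`i` algebraic cycle with `ℚ`-coefficients (Fulton §3.2, Chern classes as operators
  on the Chow group). Grothendieck 1958 §3 gives the integral `cᵢ(E) ∈ Aⁱ(X)`
  (`W.algebraicLattice`); deliberately only the weaker `ℚ`-version is axiomatised. -/
  chern_mem_ratAlgebraicClasses {n : ℕ} {X : SchemeOver k} (hX : IsSmoothProjective n X)
    {E : X.left.Modules} (hE : IsVectorBundle E) (i : ℕ) :
    chern X E i ∈ W.ratAlgebraicClasses X i

namespace ChernClassTheory

attribute [simp] chern_zero

variable {W : PreWeilCohomology k K} (C : ChernClassTheory W)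

section API

variable (X : SchemeOver k)

/-- The total Chern class `c(E) = (cᵢ(E))ᵢ ∈ ∏ᵢ H²ⁱ(X)` as a graded family
(Grothendieck 1958 §3; Fulton §3.2, `c(E) = 1 + c₁(E) + ⋯`). [cite: Grothendieck1958, §3] -/
def totalChern (E : X.left.Modules) : ∀ i : ℕ, W.obj X (2 * i) := fun i ↦ C.chern X E i

/-- The degree-`i` component of the total Chern class is `cᵢ`. [folklore] -/
@[simp]
lemma totalChern_apply (E : X.left.Modules) (i : ℕ) : C.totalChern X E i = C.chern X E i := rfl

/-- The degree-`0` component of the total Chern class is `1`. [folklore] -/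
lemma totalChern_zero (E : X.left.Modules) : C.totalChern X E 0 = W.one X := C.chern_zero X E

/-- Isomorphic modules have the same total Chern class. [folklore] -/
lemma totalChern_congr {X} {E F : X.left.Modules} (e : E ≅ F) :
    C.totalChern X E = C.totalChern X F :=
  funext fun i ↦ C.chern_congr e i

/-- Chern classes of a vector bundle are unchanged by pull-back along the identity. [folklore] -/
lemma chern_pullback_id (E : X.left.Modules) (hE : IsVectorBundle E) (i : ℕ) :
    C.chern X ((Scheme.Modules.pullback (𝟙 X : X ⟶ X).left).obj E) i = C.chern X E i := by
  rw [← C.pullback_chern (𝟙 X) E hE i, W.pullback_id]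
  rfl

/-- The positive-degree Chern classes of a zero module vanish, `cᵢ(0) = 0` for `0 < i`
(Fulton Thm 3.2 (a) with `rank 0 = 0`). [folklore] -/
theorem chern_eq_zero_of_isZero {E : X.left.Modules} (hE : IsZero E) {i : ℕ} (hi : 0 < i) :
    C.chern X E i = 0 :=
  C.chern_eq_zero_of_hasRankLE (hasRankLE_zero_of_isZero hE) hi

/-- The Chern classes of a trivial bundle vanish above its rank: `cᵢ(𝒪_X^I) = 0` for `#I < i`
(Fulton Thm 3.2 (a)). The stronger `c(𝒪_X^I) = 1` (Fulton Ex. 3.2.1) needs the normalisation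
axiom, which is not part of `ChernClassTheory`. [folklore] -/
theorem chern_trivial (I : Type u) [Finite I] {i : ℕ} (hi : Nat.card I < i) :
    C.chern X (SheafOfModules.free (R := X.left.ringCatSheaf) I) i = 0 :=
  C.chern_eq_zero_of_hasRankLE (hasRankLE_free I) hi

/-- The Whitney formula for a direct sum of vector bundles,
`c_m(E ⊞ F) = ∑_{i+j=m} cᵢ(E) ∪ cⱼ(F)` (Fulton Thm 3.2 (b)), from `chern_whitney` applied to the
split short exact sequence `0 → E → E ⊞ F → F → 0`. [folklore] -/
theorem chern_biprod (E F : X.left.Modules) (hE : IsVectorBundle E) (hF : IsVectorBundle F)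
    (m : ℕ) :
    C.chern X (E ⊞ F) m = ∑ ij : Finset.antidiagonal m,
      cupEven W X (Finset.mem_antidiagonal.mp ij.2) (C.chern X E ij.1.1) (C.chern X F ij.1.2) :=
  C.chern_whitney (ShortComplex.mk (biprod.inl : E ⟶ _) (biprod.snd : _ ⟶ F) (by simp))
    (ShortComplex.Splitting.ofHasBinaryBiproduct E F).shortExact hE hF m

/-- The first Chern class is additive on direct sums of vector bundles,
`c₁(E ⊞ F) = c₁(E) ∪ 1 + 1 ∪ c₁(F)` (Fulton Thm 3.2 (b), degree one). Under the unit axiom of a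
Weil cohomology theory this reads `c₁(E ⊞ F) = c₁(E) + c₁(F)`. [folklore] -/
theorem chern_one_biprod (E F : X.left.Modules) (hE : IsVectorBundle E) (hF : IsVectorBundle F) :
    C.chern X (E ⊞ F) 1 =
      cupEven W X (zero_add 1) (W.one X) (C.chern X F 1) +
        cupEven W X (add_zero 1) (C.chern X E 1) (W.one X) := by
  rw [C.chern_biprod X E F hE hF 1]
  have h : (Finset.univ : Finset (Finset.antidiagonal 1)) =
      {⟨(0, 1), by simp⟩, ⟨(1, 0), by simp⟩} := by decide
  rw [h, Finset.sum_pair (by decide), C.chern_zero, C.chern_zero]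

end API

/-! ## The splitting principle -/

/-- The **splitting principle** for `W` (Grothendieck 1958 §2; Fulton §3.2, Rem. 3.2.3): for
every vector bundle `E` on a `k`-scheme `X` there is a `k`-morphism `f : Y ⟶ X` such that
`f* : H•(X) → H•(Y)` is injective in every degree and `f* E` has a full flag (is a successive
extension of vector bundles of rank `≤ 1`). Classically `Y` is the complete flag variety of `E`;
v0 has no projective bundles, so this is recorded as a `Prop`-valued schema on `W`. [cite: Grothendieck1958, §2] -/
def SplittingPrinciple (W : PreWeilCohomology k K) : Prop :=
  ∀ (X : SchemeOver k) (E : X.left.Modules), IsVectorBundle E →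
    ∃ (Y : SchemeOver k) (f : Y ⟶ X), (∀ i, Function.Injective (W.pullback f i)) ∧
      HasFullFlag ((Scheme.Modules.pullback f.left).obj E)

/-- Under the splitting principle, two Chern class theories for `W` that agree on vector bundles
of rank `≤ 1` agree on all vector bundles (Grothendieck 1958 Thm 1, uniqueness step;
Fulton Rem. 3.2.3). Proof sketch: pull back along the `f` of the splitting principle (injective
on cohomology, `pullback_chern`), then induct along the flag with `chern_whitney`, feeding its
vector-bundle hypothesis by `HasFullFlag.isVectorBundle` and the rank-`≤ 1` pieces by `h` and
`chern_eq_zero_of_hasRankLE`. [cite: Grothendieck1958, Thm 1  uniqueness step] -/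
def chern_eq_of_splittingPrinciple : Prop :=
  SplittingPrinciple W → ∀ (C C' : ChernClassTheory W),
    (∀ (X : SchemeOver k) (L : X.left.Modules), HasRankLE L 1 → C.chern X L 1 = C'.chern X L 1) →
      ∀ (X : SchemeOver k) (E : X.left.Modules), IsVectorBundle E → ∀ i : ℕ,
        C.chern X E i = C'.chern X E i

end ChernClassTheory

end Literature.AlgebraicGeometry.Motives

end
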